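import Mathlib
import HarnessLib
import Summits.HubbardSuperconductivity.HubbardSuperconductivity.Theorems.KLProgrammeKLRegimeSplitEdgeFactsTransfer

/-!
# Route `KLProgramme` — edge facts for the pair masses ACROSS TRANSFERS, III: first and second DIFFERENCES OF THE RUNG `ĝ_K(ν,·)` and of a weighted rung `φ·ĝ_K`
# in the momentum, as EXACT identities in the differences of the band `e_K` and of the symbol `φ` (the jet half of the shortfall row (D2), generic part)

Cell gate-hubbard-kl, seat hubbard-kl-k3c1-p1 (g20; child-1 lineage).  Sequel to `…SplitEdgeFactsBubbleTransferModulus` (row 16: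
`|Σ_p b[a,b](Q,p) − Σ_p b[a,b](0,p)| ≤ ½(βL²)⁻¹·Σ_νΣ_p ‖g^a_ν(p)‖·‖δ²_Q g^b_ν(p)‖`, `g^e_ν(p) = e(ν,p)·ĝ_K(ν,p)`, `δ²_Q g(p) = g(p+Q) − 2g(p) + g(p−Q)`).  To USE row 16 the E1
producer needs the second differences of the weighted rungs `p ↦ φ(ν,p)·ĝ_K(ν,p)`; THIS FILE reduces them, EXACTLY, to the first/second differences of the band
`e_K = nambuXiCT` and of the symbol `φ` at step `Q` (pure algebra of `ĝ_K = 1/(−iω + e_K)`; no estimate of `e_K` or `φ` is made here):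

* §1 field algebra: `1/a − 1/b = −(a − b)/(a·b)`, **`1/a − 2/b + 1/c = −((a−b) + (c−b))/(a·c) − 2(a−b)(c−b)/(a·b·c)`** (`inv_sub_inv_eq'`, `inv_secondDiff_eq`);
* §2 the rung: with `δ⁺e = e_K(p+Q) − e_K(p)`, `δ⁻e = e_K(p−Q) − e_K(p)`, `δ²e = δ⁺e + δ⁻e`:
  `ĝ(p+Q) − ĝ(p) = −δ⁺e·ĝ(p+Q)·ĝ(p)` (`propCT_sub_propCT_eq`),
  **`δ²_Q ĝ(p) = −δ²e·ĝ(p+Q)·ĝ(p−Q) − 2·δ⁺e·δ⁻e·ĝ(p+Q)·ĝ(p)·ĝ(p−Q)`** (`propCT_secondDiff_eq`), hence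
  `‖δ²_Q ĝ(p)‖ ≤ |δ²e|·‖ĝ(p+Q)‖‖ĝ(p−Q)‖ + 2|δ⁺e||δ⁻e|·‖ĝ(p+Q)‖‖ĝ(p)‖‖ĝ(p−Q)‖` (`norm_propCT_secondDiff_le`);
* §3 the weighted rung `φ·ĝ` (discrete second-order product rule, row 14's `secondDiff_mul_prodRule` shape):
  **`‖δ²_Q(φĝ)(p)‖ ≤ |δ²_Qφ(p)|·‖ĝ(p+Q)‖ + 2|φ(p) − φ(p−Q)|·|δ⁺e|·‖ĝ(p+Q)‖‖ĝ(p)‖ + |φ(p−Q)|·‖δ²_Q ĝ(p)‖`** (`norm_weightedRung_secondDiff_le`).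

Reading for (D2)-deep: on the scale-`j` shell `‖ĝ_K‖ ≲ 1/Λ_j`, the band jets give `|δ^±_Q e_K| ≲ v·|p_Q|`, `|δ²_Q e_K| ≲ κ·|p_Q|²`, the cutoff profile gives `|δφ| ≲ |p_Q|/Λ_j`,
`|δ²φ| ≲ |p_Q|²/Λ_j²` — so every term is `O(|p_Q|²/Λ_j³) = O((|Q|·4^j)²)·‖ĝ‖`, the rate row 16 needs; those jet/profile rows are E1's.  Everything is proved; no definitions;
nothing asserts any slot, stub, K3 or superconductivity. [folklore]
-/

noncomputable section

namespace Summit.HubbardSuperconductivity.HubbardSuperconductivity.Theorems.KLRegimeSplit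

set_option linter.dupNamespace false -- summit = problem name (single-conjunct summit), D-0017

open Real Finset Literature.MathematicalPhysics.QuantumLattice Literature.Probability.LatticeModels
open Literature.MathematicalPhysics.QuantumLattice.FermiRG
open Summit.HubbardSuperconductivity.HubbardSuperconductivity.Theorems.KLProgrammeLegKernels
open Summit.HubbardSuperconductivity.HubbardSuperconductivity.Theorems.TwoPointAssembly

/-! ## §1 Field algebra: first and second differences of reciprocals -/

/-- `1/a − 1/b = −(a − b)/(a·b)` for `a, b ≠ 0`. [folklore] -/
theorem inv_sub_inv_eq' {a b : ℂ} (ha : a ≠ 0) (hb : b ≠ 0) : 1 / a - 1 / b = -(a - b) / (a * b) := by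
  field_simp
  ring

/-- **The second difference of a reciprocal**: `1/a − 2/b + 1/c = −((a − b) + (c − b))/(a·c) − 2(a − b)(c − b)/(a·b·c)` for `a, b, c ≠ 0`. [folklore] -/
theorem inv_secondDiff_eq {a b c : ℂ} (ha : a ≠ 0) (hb : b ≠ 0) (hc : c ≠ 0) :
    1 / a - 2 * (1 / b) + 1 / c = -((a - b) + (c - b)) / (a * c) - 2 * ((a - b) * (c - b)) / (a * b * c) := by
  field_simp
  ring

/-! ## §2 The rung `ĝ_K(ν,·)`: differences in the momentum -/

section Rung

variable {L M : ℕ} {β : ℝ} (μ : ℝ) (K : TrigPolyC4v)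

/-- The rung as a reciprocal: `ĝ_K(k) = 1/(−iω_k + e_K(k⃗))` with a nonzero denominator (`β ≠ 0`). [folklore] -/
theorem propCT_eq_one_div (hβ : β ≠ 0) (k : FreqMomentum L M) :
    propCT L M β μ K k = 1 / (-Complex.I * (matsubaraFreq β M k.1 : ℂ) + (nambuXiCT L μ K k.2 : ℂ)) ∧
      (-Complex.I * (matsubaraFreq β M k.1 : ℂ) + (nambuXiCT L μ K k.2 : ℂ)) ≠ 0 := by
  refine ⟨rfl, fun h => ?_⟩
  have him := congrArg Complex.im h
  simp at him
  exact matsubaraFreq_ne_zero hβ k.1 him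

/-- **First difference of the rung**: `ĝ(ν, p+Q) − ĝ(ν, p) = −(e_K(p+Q) − e_K(p))·ĝ(ν, p+Q)·ĝ(ν, p)`. [folklore] -/
theorem propCT_sub_propCT_eq (hβ : β ≠ 0) (ν : MatsubaraIdx M) (p Q : TorusSite 2 L) :
    propCT L M β μ K (ν, p + Q) - propCT L M β μ K (ν, p) =
      -((nambuXiCT L μ K (p + Q) - nambuXiCT L μ K p : ℝ) : ℂ) * (propCT L M β μ K (ν, p + Q) * propCT L M β μ K (ν, p)) := by
  obtain ⟨ha, ha0⟩ := propCT_eq_one_div μ K hβ ((ν, p + Q) : FreqMomentum L M)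
  obtain ⟨hb, hb0⟩ := propCT_eq_one_div μ K hβ ((ν, p) : FreqMomentum L M)
  rw [ha, hb, inv_sub_inv_eq' ha0 hb0]
  push_cast
  field_simp
  ring

/-- **Second difference of the rung**: with `δ⁺e = e_K(p+Q) − e_K(p)`, `δ⁻e = e_K(p−Q) − e_K(p)`,
`ĝ(p+Q) − 2ĝ(p) + ĝ(p−Q) = −(δ⁺e + δ⁻e)·ĝ(p+Q)·ĝ(p−Q) − 2·δ⁺e·δ⁻e·ĝ(p+Q)·ĝ(p)·ĝ(p−Q)` (frequency `ν` fixed). [folklore] -/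
theorem propCT_secondDiff_eq (hβ : β ≠ 0) (ν : MatsubaraIdx M) (p Q : TorusSite 2 L) :
    propCT L M β μ K (ν, p + Q) - 2 * propCT L M β μ K (ν, p) + propCT L M β μ K (ν, p - Q) =
      -((nambuXiCT L μ K (p + Q) - nambuXiCT L μ K p + (nambuXiCT L μ K (p - Q) - nambuXiCT L μ K p) : ℝ) : ℂ) *
          (propCT L M β μ K (ν, p + Q) * propCT L M β μ K (ν, p - Q)) -
        2 * (((nambuXiCT L μ K (p + Q) - nambuXiCT L μ K p) * (nambuXiCT L μ K (p - Q) - nambuXiCT L μ K p) : ℝ) : ℂ) *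
          (propCT L M β μ K (ν, p + Q) * propCT L M β μ K (ν, p) * propCT L M β μ K (ν, p - Q)) := by
  obtain ⟨ha, ha0⟩ := propCT_eq_one_div μ K hβ ((ν, p + Q) : FreqMomentum L M)
  obtain ⟨hb, hb0⟩ := propCT_eq_one_div μ K hβ ((ν, p) : FreqMomentum L M)
  obtain ⟨hc, hc0⟩ := propCT_eq_one_div μ K hβ ((ν, p - Q) : FreqMomentum L M)
  rw [ha, hb, hc, inv_secondDiff_eq ha0 hb0 hc0]
  push_cast
  field_simp
  ring

/-- **Second difference of the rung, bound**:
`‖ĝ(p+Q) − 2ĝ(p) + ĝ(p−Q)‖ ≤ |δ²e|·‖ĝ(p+Q)‖·‖ĝ(p−Q)‖ + 2·|δ⁺e|·|δ⁻e|·‖ĝ(p+Q)‖·‖ĝ(p)‖·‖ĝ(p−Q)‖`. [folklore] -/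
theorem norm_propCT_secondDiff_le (hβ : β ≠ 0) (ν : MatsubaraIdx M) (p Q : TorusSite 2 L) :
    ‖propCT L M β μ K (ν, p + Q) - 2 * propCT L M β μ K (ν, p) + propCT L M β μ K (ν, p - Q)‖ ≤
      |nambuXiCT L μ K (p + Q) - nambuXiCT L μ K p + (nambuXiCT L μ K (p - Q) - nambuXiCT L μ K p)| *
          (‖propCT L M β μ K (ν, p + Q)‖ * ‖propCT L M β μ K (ν, p - Q)‖) +
        2 * (|nambuXiCT L μ K (p + Q) - nambuXiCT L μ K p| * |nambuXiCT L μ K (p - Q) - nambuXiCT L μ K p|) *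
          (‖propCT L M β μ K (ν, p + Q)‖ * ‖propCT L M β μ K (ν, p)‖ * ‖propCT L M β μ K (ν, p - Q)‖) := by
  rw [propCT_secondDiff_eq μ K hβ ν p Q]
  refine (norm_sub_le _ _).trans (le_of_eq ?_)
  simp only [norm_mul, norm_neg, Complex.norm_real, Real.norm_eq_abs, Complex.norm_ofNat]

end Rung

/-! ## §3 The weighted rung `φ·ĝ_K`: the discrete second-order product rule -/

section Weighted

variable {L M : ℕ} {β : ℝ} (μ : ℝ) (K : TrigPolyC4v)

/-- The discrete second-order product rule over `ℂ`: `a₂b₂ − 2a₁b₁ + a₀b₀ = (a₂ − 2a₁ + a₀)·b₂ + 2(a₁ − a₀)(b₂ − b₁) + a₀·(b₂ − 2b₁ + b₀)`. [folklore] -/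
theorem secondDiff_mul_prodRule_complex (a₀ a₁ a₂ b₀ b₁ b₂ : ℂ) :
    a₂ * b₂ - 2 * (a₁ * b₁) + a₀ * b₀ = (a₂ - 2 * a₁ + a₀) * b₂ + 2 * ((a₁ - a₀) * (b₂ - b₁)) + a₀ * (b₂ - 2 * b₁ + b₀) := by ring

/-- **Second difference of a weighted rung, bound** (`φ` real; index `0 ↔ p−Q`, `1 ↔ p`, `2 ↔ p+Q`):
`‖(φĝ)(p+Q) − 2(φĝ)(p) + (φĝ)(p−Q)‖ ≤ |φ(p+Q) − 2φ(p) + φ(p−Q)|·‖ĝ(p+Q)‖ + 2|φ(p) − φ(p−Q)|·|e_K(p+Q) − e_K(p)|·‖ĝ(p+Q)‖‖ĝ(p)‖ + |φ(p−Q)|·‖δ²_Q ĝ(p)‖`. [folklore] -/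
theorem norm_weightedRung_secondDiff_le (hβ : β ≠ 0) (φ : FreqMomentum L M → ℝ) (ν : MatsubaraIdx M) (p Q : TorusSite 2 L) :
    ‖(φ (ν, p + Q) : ℂ) * propCT L M β μ K (ν, p + Q) - 2 * ((φ (ν, p) : ℂ) * propCT L M β μ K (ν, p)) +
        (φ (ν, p - Q) : ℂ) * propCT L M β μ K (ν, p - Q)‖ ≤
      |φ (ν, p + Q) - 2 * φ (ν, p) + φ (ν, p - Q)| * ‖propCT L M β μ K (ν, p + Q)‖ +
        2 * (|φ (ν, p) - φ (ν, p - Q)| * (|nambuXiCT L μ K (p + Q) - nambuXiCT L μ K p| *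
          (‖propCT L M β μ K (ν, p + Q)‖ * ‖propCT L M β μ K (ν, p)‖))) +
        |φ (ν, p - Q)| * ‖propCT L M β μ K (ν, p + Q) - 2 * propCT L M β μ K (ν, p) + propCT L M β μ K (ν, p - Q)‖ := by
  set G₂ := propCT L M β μ K (ν, p + Q)
  set G₁ := propCT L M β μ K (ν, p)
  set G₀ := propCT L M β μ K (ν, p - Q)
  rw [secondDiff_mul_prodRule_complex (φ (ν, p - Q) : ℂ) (φ (ν, p) : ℂ) (φ (ν, p + Q) : ℂ) G₀ G₁ G₂]
  have hdiff : G₂ - G₁ = -((nambuXiCT L μ K (p + Q) - nambuXiCT L μ K p : ℝ) : ℂ) * (G₂ * G₁) := propCT_sub_propCT_eq μ K hβ ν p Q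
  refine (norm_add₃_le).trans ?_
  refine add_le_add (add_le_add (le_of_eq ?_) (le_of_eq ?_)) (le_of_eq ?_)
  · rw [norm_mul, show (φ (ν, p + Q) : ℂ) - 2 * (φ (ν, p) : ℂ) + (φ (ν, p - Q) : ℂ) = ((φ (ν, p + Q) - 2 * φ (ν, p) + φ (ν, p - Q) : ℝ) : ℂ) by push_cast; ring,
      Complex.norm_real, Real.norm_eq_abs]
  · rw [norm_mul, Complex.norm_ofNat, norm_mul, show (φ (ν, p) : ℂ) - (φ (ν, p - Q) : ℂ) = ((φ (ν, p) - φ (ν, p - Q) : ℝ) : ℂ) by push_cast; ring,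
      Complex.norm_real, Real.norm_eq_abs, hdiff, norm_mul, norm_neg, Complex.norm_real, Real.norm_eq_abs, norm_mul]
  · rw [norm_mul, Complex.norm_real, Real.norm_eq_abs]

end Weighted

end Summit.HubbardSuperconductivity.HubbardSuperconductivity.Theorems.KLRegimeSplit

end
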